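import Summits.QuantumFields.YangMills.Theorems.FluctuationComparisonRegPrIntLS2BetaSqrtGaugeStageTBlock
import Summits.QuantumFields.YangMills.Theorems.FluctuationComparisonRegPrIntLS2BetaMonotoneStretch
import HarnessLib

/-!
# S2β · D-GUARD ∕ (BG∞) — THE CONE ON A DISCRETE RECTANGLE ((R2) of FINDING (BX): `hSec`'s class-2 blocks have slices `{0..nα} × {0..nβ}` with sides in
# `{c, c+1}`; the landed square cone ✓p839841 `exists_coneOnSquare` on `{0..nα}²` is transported to the rectangle by the monotone stretch ✓∕⧗(R1)
# (`ψ (i, j) := φ (i, σ j)`, `W φ (i, j′) := Wsq ψ (i, τ j′)`), with the ring letters taken PER BOND (what (L-Σ) has) and ✓p839846 T0 applied inside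

Cell `ym3-torus` (YM ladder rung R3 = continuum `SU(2)` Yang–Mills on the three-torus at fixed lattice data — a RUNG: NOT d = 4, NOT infinite volume,
NOT a mass gap, NOT Clay).  Width seat «width 5» `ym3-torus-px5` (gen 24), FREE px helper on crux `stmt-QuantumFields-20520` (`FluctuationComparisonRegPrIntL`;
registry `Lines/semiclassical_s2beta.lean` UNTOUCHED, 0∕5); `--kind proof --supports stmt-QuantumFields-20520 --as helper`, count-neutral, DEFINITION-FREE
(0 `def`, 0 `instance`, 0 `notation`, 0 `sorry`, default heartbeats).

WHY.  ✓`exists_parityBlocks` cuts `ZMod N` into `M` intervals of lengths `c` and `c + 1` (`N = M·c + r`), the same partition on every axis, so a class-2 block of the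
8-colour scheme has `(α, β)`-slices `{0..nα} × {0..nβ}` with `{nα, nβ} ⊂ {c, c+1}` — rectangles, not squares.  Naming `α` the longer odd axis (`nβ ≤ nα ≤ 2nβ`),
the compression `σ` (`{0..nα} → {0..nβ}`, unit steps) pulls the rectangle's ring data back to square ring data `ψ (i, j) := φ (i, σ j)` with the SAME per-bond
oscillation (a `σ`-step is `0` or `1`), the square cone `Wsq ψ` of ✓T2 is read back through the stretch `τ` (`{0..nβ} → {0..nα}`, steps `≤ 2`, `σ ∘ τ = id`):
`W φ (i, j′) := Wsq ψ (i, τ j′)`.  Ring agreement by `σ (τ j′) = j′` and `τ 0 = 0`, `τ nβ = nα`; cap position verbatim; horizontal steps = square steps, vertical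
steps ≤ two square steps; slice-to-slice closeness verbatim.  Square steps: per-bond `η` ⟹ (✓`ringAdj_of_steps`, ✓T0 `dist1_boundary_le_two_mul_l1`) modulus `2η`
⟹ (T2 (iii)) `6Λη + 3(π−r)∕nα`; rectangle steps `≤ 12Λη + 6(π−r)∕nα`, `Λ = (π − r)∕sin r`.

WHAT IS PROVED (sorry-free; «ring» of the rectangle = `i ≤ nα ∧ j ≤ nβ ∧ (i = 0 ∨ i = nα ∨ j = 0 ∨ j = nβ)`).
* §1 `dist1_two_steps_le` (a chain of `≤ 2` steps), `squareRing_h_of_rect`, `squareRing_v_of_rect` (the square ring letters of `ψ` from the rectangle's).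
* §2 ★★★ `exists_coneOnRect (nα nβ) (hn : 2 ≤ nβ) (hβα : nβ ≤ nα) (hαβ : nα ≤ 2·nβ) (hr : 0 < r) (hrπ : r < π) (a) : ∃ W : (ℕ × ℕ → SU2) → (ℕ × ℕ → SU2), ∀ φ,
  ring cap → (i) `W φ = φ` on the ring ∧ (ii) `‖logVec (a⁻¹·W φ (i,j))‖ ≤ π − r` on the rectangle ∧ (iii′) `∀ η ≥ 0`, PER-BOND ring oscillation `≤ η` (forward
  horizontal and vertical ring bonds) ⟹ both lattice steps `≤ 12Λη + 6(π−r)∕nα` ∧ (iv) ring caps for `φ′` and ring-pointwise `dist1 (φ·φ′⁻¹) ≤ μ` ⟹ pointwise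
  `dist1 (W φ·(W φ′)⁻¹) ≤ Λμ`.`

HONEST SCOPE.  Transport of landed sphere∕lattice geometry (✓p839841, ✓p839846, ✓p840047 §1) by arithmetic (✓∕⧗(R1)); no gauge field; nothing of Bałaban's
renormalisation-group analysis is asserted or proved ([Balaban1985RegularSpaces] Thm 2 p.83 — local small gauges).  `hSec` ∕ (BG∞) ∕ `hsupp⁺` are CONJECTURES (plan
§116) and NOT proved; GAP♯∘ (registry UNTOUCHED), the five registered stubs (0∕5), S2β, 20520, 19936, 19200, `YM3TorusSU2` are NOT proved; no registered stub is
closed; rung R3 — NOT d = 4, NOT infinite volume, NOT a mass gap, NOT Clay; the Yang–Mills mass gap is NOT proved.  Axioms standard.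

References: T. Bałaban, CMP **99** (1985) 75–102 [Balaban1985RegularSpaces] (Thm 2 p.83).
-/

set_option autoImplicit false

noncomputable section

namespace Summit.QuantumFields.YangMills.Theorems.FluctuationComparisonRegPrIntLS2BetaConeOnRectangle

open scoped Real
open Literature.MathematicalPhysics.QuantumLattice (su2Quat)
open Literature.MathematicalPhysics.QuantumFieldTheory.Balaban1983to89
open T4CubeChartGnomonic (SU2)
open T4ExpWindowSmallField (logVec)
open Summit.QuantumFields.YangMills.Theorems.FluctuationComparisonRegPrIntLS2BetaConeFilling (dist1_mul_inv_le_via)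
open Summit.QuantumFields.YangMills.Theorems.FluctuationComparisonRegPrIntLS2BetaConeOnSquare (exists_coneOnSquare)
open Summit.QuantumFields.YangMills.Theorems.FluctuationComparisonRegPrIntLS2BetaSquareRingModulus (dist1_boundary_le_two_mul_l1)
open Summit.QuantumFields.YangMills.Theorems.FluctuationComparisonRegPrIntLS2BetaSqrtGaugeStageTBlock (ringAdj_of_steps)
open Summit.QuantumFields.YangMills.Theorems.FluctuationComparisonRegPrIntLS2BetaMonotoneStretch (exists_stretch)

/-! ## §1 Small tools -/

/-- A chain of at most two steps: if `v ∈ {u, u+1, u+2}` and consecutive values are `B`-close (`B ≥ 0`), then `dist1 (f u·(f v)⁻¹) ≤ 2B`. [folklore] -/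
theorem dist1_two_steps_le {G : Type*} [GaugeGroup G] (f : ℕ → G) {B : ℝ} (hB : 0 ≤ B) (u v : ℕ) (huv : v = u ∨ v = u + 1 ∨ v = u + 2)
    (h1 : v = u + 1 ∨ v = u + 2 → dist1 (f u * (f (u + 1))⁻¹) ≤ B) (h2 : v = u + 2 → dist1 (f (u + 1) * (f (u + 2))⁻¹) ≤ B) :
    dist1 (f u * (f v)⁻¹) ≤ 2 * B := by
  rcases huv with h | h | h
  · rw [h, mul_inv_cancel, GaugeGroup.dist1_one]; linarith
  · rw [h]; linarith [h1 (Or.inl h)]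
  · rw [h]
    exact (dist1_mul_inv_le_via _ (f (u + 1)) _).trans (by linarith [h1 (Or.inr h), h2 h])

/-- **The square's horizontal ring letters from the rectangle's**: for `ψ (i, j) := φ (i, σ j)` with `σ {0, nα} = {0, nβ}`, `σ ≤ nβ` on `{0..nα}`, every forward horizontal
bond of the square ring is a forward horizontal bond of the rectangle ring (`nα ≥ 2`). [folklore] -/
theorem squareRing_h_of_rect {G : Type*} [GaugeGroup G] (nα nβ : ℕ) (hn : 2 ≤ nα) (φ : ℕ × ℕ → G) (σ : ℕ → ℕ)
    (hσ0 : σ 0 = 0) (hσa : σ nα = nβ) (hσle : ∀ j, j ≤ nα → σ j ≤ nβ) {η : ℝ}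
    (hH : ∀ i j, i + 1 ≤ nα → j ≤ nβ → (i = 0 ∨ i = nα ∨ j = 0 ∨ j = nβ) → (i + 1 = nα ∨ j = 0 ∨ j = nβ) →
      dist1 (φ (i, j) * (φ (i + 1, j))⁻¹) ≤ η) :
    ∀ i k, i + 1 ≤ nα → k ≤ nα → (i = 0 ∨ i = nα ∨ k = 0 ∨ k = nα) → (i + 1 = nα ∨ k = 0 ∨ k = nα) →
      dist1 ((fun q : ℕ × ℕ => φ (q.1, σ q.2)) (i, k) * ((fun q : ℕ × ℕ => φ (q.1, σ q.2)) (i + 1, k))⁻¹) ≤ η := by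
  intro i k hi hk hb hb'
  have hk' : σ k = 0 ∨ σ k = nβ ∨ ¬ (k = 0 ∨ k = nα) := by
    rcases Nat.eq_or_lt_of_le (Nat.zero_le k) with h | _
    · exact Or.inl (by rw [← h, hσ0])
    · by_cases hka : k = nα
      · exact Or.inr (Or.inl (by rw [hka, hσa]))
      · by_cases hk0 : k = 0
        · exact Or.inl (by rw [hk0, hσ0])
        · exact Or.inr (Or.inr (by omega))
  rcases hk' with h | h | h
  · exact hH i (σ k) hi (hσle k hk) (Or.inr (Or.inr (Or.inl h))) (Or.inr (Or.inl h))
  · exact hH i (σ k) hi (hσle k hk) (Or.inr (Or.inr (Or.inr h))) (Or.inr (Or.inr h))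
  · exfalso; omega

/-- **The square's vertical ring letters from the rectangle's**: a `σ`-step is `0` (then the letter is `dist1 1 = 0`) or `1` (a vertical rectangle ring bond). [folklore] -/
theorem squareRing_v_of_rect {G : Type*} [GaugeGroup G] (nα nβ : ℕ) (hn : 2 ≤ nα) (φ : ℕ × ℕ → G) (σ : ℕ → ℕ)
    (hσm : ∀ j, σ j ≤ σ (j + 1)) (hσs : ∀ j, σ (j + 1) ≤ σ j + 1) (hσle : ∀ j, j ≤ nα → σ j ≤ nβ) {η : ℝ} (hη : 0 ≤ η)
    (hV : ∀ i j, i ≤ nα → j + 1 ≤ nβ → (i = 0 ∨ i = nα ∨ j = 0 ∨ j = nβ) → (i = 0 ∨ i = nα ∨ j + 1 = nβ) →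
      dist1 (φ (i, j) * (φ (i, j + 1))⁻¹) ≤ η) :
    ∀ i k, i ≤ nα → k + 1 ≤ nα → (i = 0 ∨ i = nα ∨ k = 0 ∨ k = nα) → (i = 0 ∨ i = nα ∨ k + 1 = nα) →
      dist1 ((fun q : ℕ × ℕ => φ (q.1, σ q.2)) (i, k) * ((fun q : ℕ × ℕ => φ (q.1, σ q.2)) (i, k + 1))⁻¹) ≤ η := by
  intro i k hi hk hb hb'
  by_cases hI : i = 0 ∨ i = nα
  · rcases (show σ (k + 1) = σ k ∨ σ (k + 1) = σ k + 1 by have := hσm k; have := hσs k; omega) with h | h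
    · show dist1 (φ (i, σ k) * (φ (i, σ (k + 1)))⁻¹) ≤ η
      rw [h, mul_inv_cancel, GaugeGroup.dist1_one]; exact hη
    · show dist1 (φ (i, σ k) * (φ (i, σ (k + 1)))⁻¹) ≤ η
      rw [h]
      have hk1 : σ k + 1 ≤ nβ := by have := hσle (k + 1) hk; omega
      exact hV i (σ k) hi hk1 (by rcases hI with h0 | h0 <;> simp [h0]) (by rcases hI with h0 | h0 <;> simp [h0])
  · exfalso; omega

/-! ## §2 The cone on the rectangle -/

/-- ★★★ **THE CONE ON A DISCRETE RECTANGLE (STAGE T ON ONE SLICE OF A BOX-BLOCK)**: for `2 ≤ nβ ≤ nα ≤ 2nβ`, `0 < r < π` and a centre `a` there is an OPERATOR `W`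
on data `φ : ℕ × ℕ → SU2` such that for every `φ` whose ring values (ring of `{0..nα} × {0..nβ}`) lie within arc `π − r` of `a`: (i) `W φ = φ` on the ring, (ii) `W φ`
stays within arc `π − r` of `a` on the rectangle, (iii′) for every `η ≥ 0` bounding the data's forward ring bonds, both lattice steps of `W φ` are
`≤ 12·((π−r)∕sin r)·η + 6·(π−r)∕nα`, and (iv) two data pointwise `μ`-close on the ring have fillings pointwise `((π−r)∕sin r)·μ`-close.
`W φ (i, j′) := Wsq (fun q ↦ φ (q.1, σ q.2)) (i, τ j′)` over ✓`exists_coneOnSquare nα` and ✓∕⧗`exists_stretch nα nβ`. [cite: Balaban1985RegularSpaces, Thm 2 p.83] -/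
theorem exists_coneOnRect (nα nβ : ℕ) (hn : 2 ≤ nβ) (hβα : nβ ≤ nα) (hαβ : nα ≤ 2 * nβ) {r : ℝ} (hr : 0 < r) (hrπ : r < π) (a : SU2) :
    ∃ W : (ℕ × ℕ → SU2) → (ℕ × ℕ → SU2), ∀ φ : ℕ × ℕ → SU2,
      (∀ i j, i ≤ nα → j ≤ nβ → (i = 0 ∨ i = nα ∨ j = 0 ∨ j = nβ) → ‖logVec (su2Quat (a⁻¹ * φ (i, j)))‖ ≤ π - r) →
      (∀ i j, i ≤ nα → j ≤ nβ → (i = 0 ∨ i = nα ∨ j = 0 ∨ j = nβ) → W φ (i, j) = φ (i, j)) ∧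
      (∀ i j, i ≤ nα → j ≤ nβ → ‖logVec (su2Quat (a⁻¹ * W φ (i, j)))‖ ≤ π - r) ∧
      (∀ η : ℝ, 0 ≤ η →
        (∀ i j, i + 1 ≤ nα → j ≤ nβ → (i = 0 ∨ i = nα ∨ j = 0 ∨ j = nβ) → (i + 1 = nα ∨ j = 0 ∨ j = nβ) →
          dist1 (φ (i, j) * (φ (i + 1, j))⁻¹) ≤ η) →
        (∀ i j, i ≤ nα → j + 1 ≤ nβ → (i = 0 ∨ i = nα ∨ j = 0 ∨ j = nβ) → (i = 0 ∨ i = nα ∨ j + 1 = nβ) →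
          dist1 (φ (i, j) * (φ (i, j + 1))⁻¹) ≤ η) →
        (∀ i j, i + 1 ≤ nα → j ≤ nβ →
          dist1 (W φ (i, j) * (W φ (i + 1, j))⁻¹) ≤ 12 * ((π - r) / Real.sin r) * η + 6 * (π - r) / nα) ∧
        (∀ i j, i ≤ nα → j + 1 ≤ nβ →
          dist1 (W φ (i, j) * (W φ (i, j + 1))⁻¹) ≤ 12 * ((π - r) / Real.sin r) * η + 6 * (π - r) / nα)) ∧
      (∀ φ' : ℕ × ℕ → SU2, ∀ μ : ℝ,
        (∀ i j, i ≤ nα → j ≤ nβ → (i = 0 ∨ i = nα ∨ j = 0 ∨ j = nβ) → ‖logVec (su2Quat (a⁻¹ * φ' (i, j)))‖ ≤ π - r) →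
        (∀ i j, i ≤ nα → j ≤ nβ → (i = 0 ∨ i = nα ∨ j = 0 ∨ j = nβ) → dist1 (φ (i, j) * (φ' (i, j))⁻¹) ≤ μ) →
        ∀ i j, i ≤ nα → j ≤ nβ → dist1 (W φ (i, j) * (W φ' (i, j))⁻¹) ≤ ((π - r) / Real.sin r) * μ) := by
  obtain ⟨σ, τ, hσ0, hσa, hσm, hσs, hσle, hτ0, hτb, hτm, hτs, hτle, hστ⟩ := exists_stretch nα nβ (by omega) hβα hαβ
  have hnα : 2 ≤ nα := le_trans hn hβα
  obtain ⟨Wsq, hWsq⟩ := exists_coneOnSquare nα hnα hr hrπ a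
  have hΛ0 : 0 ≤ (π - r) / Real.sin r := div_nonneg (by linarith) (Real.sin_nonneg_of_nonneg_of_le_pi hr.le hrπ.le)
  have hπr : 0 ≤ 3 * (π - r) / nα := div_nonneg (by linarith) (Nat.cast_nonneg _)
  -- the ring of the square point `(i, τ j)` / `(i, σ-image)`
  have ringτ : ∀ i j, j ≤ nβ → (i = 0 ∨ i = nα ∨ j = 0 ∨ j = nβ) → (i = 0 ∨ i = nα ∨ τ j = 0 ∨ τ j = nα) := by
    intro i j _ hb
    rcases hb with h | h | h | h
    · exact Or.inl h
    · exact Or.inr (Or.inl h)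
    · exact Or.inr (Or.inr (Or.inl (by rw [h, hτ0])))
    · exact Or.inr (Or.inr (Or.inr (by rw [h, hτb])))
  have ringσ : ∀ i k, k ≤ nα → (i = 0 ∨ i = nα ∨ k = 0 ∨ k = nα) → (i = 0 ∨ i = nα ∨ σ k = 0 ∨ σ k = nβ) := by
    intro i k _ hb
    rcases hb with h | h | h | h
    · exact Or.inl h
    · exact Or.inr (Or.inl h)
    · exact Or.inr (Or.inr (Or.inl (by rw [h, hσ0])))
    · exact Or.inr (Or.inr (Or.inr (by rw [h, hσa])))
  -- square ring cap of the pulled-back datum from the rectangle's ring cap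
  have capψ : ∀ φ : ℕ × ℕ → SU2,
      (∀ i j, i ≤ nα → j ≤ nβ → (i = 0 ∨ i = nα ∨ j = 0 ∨ j = nβ) → ‖logVec (su2Quat (a⁻¹ * φ (i, j)))‖ ≤ π - r) →
      ∀ i k, i ≤ nα → k ≤ nα → (i = 0 ∨ i = nα ∨ k = 0 ∨ k = nα) →
        ‖logVec (su2Quat (a⁻¹ * (fun q : ℕ × ℕ => φ (q.1, σ q.2)) (i, k)))‖ ≤ π - r :=
    fun φ hcap i k hi hk hb => hcap i (σ k) hi (hσle k hk) (ringσ i k hk hb)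
  refine ⟨fun φ p => Wsq (fun q : ℕ × ℕ => φ (q.1, σ q.2)) (p.1, τ p.2), fun φ hcap => ?_⟩
  obtain ⟨h1, h2, h3, h4⟩ := hWsq (fun q : ℕ × ℕ => φ (q.1, σ q.2)) (capψ φ hcap)
  refine ⟨fun i j hi hj hb => ?_, fun i j hi hj => ?_, fun η hη hH hV => ?_, fun φ' μ hcap' hclose i j hi hj => ?_⟩
  · -- (i) ring agreement
    show Wsq (fun q : ℕ × ℕ => φ (q.1, σ q.2)) (i, τ j) = φ (i, j)
    rw [h1 i (τ j) hi (hτle j hj) (ringτ i j hj hb)]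
    show φ (i, σ (τ j)) = φ (i, j)
    rw [hστ]
  · -- (ii) cap position
    exact h2 i (τ j) hi (hτle j hj)
  · -- (iii′) steps from per-bond ring letters
    have hadj := ringAdj_of_steps nα (fun q : ℕ × ℕ => φ (q.1, σ q.2))
      (squareRing_h_of_rect nα nβ hnα φ σ hσ0 hσa hσle hH) (squareRing_v_of_rect nα nβ hnα φ σ hσm hσs hσle hη hV)
    obtain ⟨hh, hv⟩ := h3 (2 * η) (by positivity) (dist1_boundary_le_two_mul_l1 nα _ hη hadj)
    have hB0 : 0 ≤ 3 * ((π - r) / Real.sin r) * (2 * η) + 3 * (π - r) / nα := add_nonneg (by positivity) hπr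
    have hBB : (2 : ℝ) * (3 * ((π - r) / Real.sin r) * (2 * η) + 3 * (π - r) / nα) = 12 * ((π - r) / Real.sin r) * η + 6 * (π - r) / nα := by ring
    refine ⟨fun i j hi hj => ?_, fun i j hi hj => ?_⟩
    · -- horizontal: one square step at `(i, τ j)`
      show dist1 (Wsq (fun q : ℕ × ℕ => φ (q.1, σ q.2)) (i, τ j) * (Wsq (fun q : ℕ × ℕ => φ (q.1, σ q.2)) (i + 1, τ j))⁻¹) ≤ _
      rw [← hBB]
      linarith [hh i (τ j) hi (hτle j hj)]
    · -- vertical: at most two square steps from `(i, τ j)` to `(i, τ (j+1))`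
      show dist1 (Wsq (fun q : ℕ × ℕ => φ (q.1, σ q.2)) (i, τ j) * (Wsq (fun q : ℕ × ℕ => φ (q.1, σ q.2)) (i, τ (j + 1)))⁻¹) ≤ _
      rw [← hBB]
      have hτj1 : τ (j + 1) ≤ nα := hτle (j + 1) hj
      refine dist1_two_steps_le (fun v => Wsq (fun q : ℕ × ℕ => φ (q.1, σ q.2)) (i, v)) hB0 (τ j) (τ (j + 1))
        (by have := hτm j; have := hτs j; omega) (fun hc => ?_) (fun hc => ?_)
      · exact hv i (τ j) hi (by omega)
      · have h' := hv i (τ j + 1) hi (by omega)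
        simpa [add_assoc] using h'
  · -- (iv) slice to slice
    exact h4 (fun q : ℕ × ℕ => φ' (q.1, σ q.2)) μ (capψ φ' hcap')
      (fun i' k hi' hk hb => hclose i' (σ k) hi' (hσle k hk) (ringσ i' k hk hb)) i (τ j) hi (hτle j hj)

end Summit.QuantumFields.YangMills.Theorems.FluctuationComparisonRegPrIntLS2BetaConeOnRectangle

end
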